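import Literature.NumberTheory.GaloisRepresentations.ContinuousCohomologySmulSequences
import Literature.Algebra.Module.RankModPrimeElement
import Literature.Algebra.Module.CharacterModuleRankSequences
import HarnessLib

/-!
# Coranks of continuous cohomology modulo a prime element of the coefficient ring

Topic `NumberTheory/GaloisRepresentations`; namespace `Literature.NumberTheory.GaloisRepresentations`;
THEOREMS ONLY (no definition, no named fact, no `sorry`).

Let `Γ` be a compact group, `R` a commutative Noetherian domain (with a ring topology), `T ∈ R` a
non-zero prime element, `R' = R/(T)`, and `D` a discrete `R`-module with finitely generated
Pontryagin dual `X = D^∨` and a continuous `R`-linear `Γ`-action.  Writing `Xⁿ = Hⁿ(Γ, D)^∨`,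
this file proves the three book-keeping identities behind R. Greenberg's reduction of corank
formulas to smaller Krull dimension (*On the structure of certain Galois cohomology groups*
(2006), proof of Props. 4.1/4.2, p. 368 L25–52: "The Euler–Poincaré characteristic is additive …
`D/D_{Λ-div}` is `Λ`-cotorsion … we can assume … that `D` is `Λ`-divisible … reducing to the case
of the … modules `D[Tⁿ]` … `D[P]` considered as a module over … `(Λ/P)`"):

* `finrank_characterModule_H_eq_of_smul_mem` — if `u D ⊆ D'` for a `Γ`-stable `D' ≤ D` and
  `u ≠ 0`, then `rank_R Hⁿ(Γ, D)^∨ = rank_R Hⁿ(Γ, D')^∨` (and `rank_R D^∨ = rank_R D'^∨`,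
  `finrank_characterModule_eq_of_smul_mem`): cotorsion submodules do not change coranks;
* `alternatingSum_finrank_torsionBy_characterModule_H_eq` — for `0 → A → D →(T·) D → 0` exact
  (`D` `T`-divisible, `A = D[T]`) and `H³(Γ, A) = 0`:
  `Σ_{i≤2} (−1)ⁱ rank_{R'} Hⁱ(Γ, A)^∨ = Σ_{i≤2} (−1)ⁱ rank_R Hⁱ(Γ, D)^∨`, the `R'`-ranks of the
  `T`-killed modules `Hⁱ(Γ, A)^∨` being read on their `T`-torsion (all of them);
* `finrank_characterModule_eq_finrank_torsionBy_of_addEquiv` /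
  `finrank_characterModule_H_quotientRing_eq` — the `R'`-rank of `Hⁱ(Γ, A)^∨` for `A` viewed as
  an `R'`-representation equals the above `R'`-rank (cohomology does not see the scalars).

## References
* R. Greenberg, *On the structure of certain Galois cohomology groups*, Doc. Math. Extra Vol.
  Coates (2006) 335–391, §4 A (p. 368 L25–52), §3 A (pp. 358–359). [Greenberg2006]
-/

noncomputable section

open CategoryTheory Limits

namespace Literature.NumberTheory.GaloisRepresentations

open _root_.TopRep _root_.ContRepresentation _root_.ContinuousCohomology
open _root_.Module Submodule Literature.Algebra.Module

/-! ## §1. Transport of `R'`-ranks of duals along semilinear additive equivalences -/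

section Transport

variable {R : Type} [CommRing R] (T : R)
  {N : Type} [AddCommGroup N] [Module R N] {N' : Type} [AddCommGroup N']
  [Module (R ⧸ Ideal.span {T}) N']

/-- If `Φ : N ≃+ N'` carries `r·x` to `(r mod T)·Φ x` (`N` an `R`-module, `N'` an `R/(T)`-module),
then `χ ↦ χ ∘ Φ⁻¹` is an `R/(T)`-linear bijection `N^∨[T] = N^∨ ≃ N'^∨`; in particular the
`R/(T)`-ranks agree. [cite: Greenberg2006, §4 A (proof of Props. 4.1/4.2, p. 368 L49–52)] -/
theorem finrank_characterModule_eq_finrank_torsionBy_of_addEquiv (Φ : N ≃+ N')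
    (hΦ : ∀ (r : R) (x : N), Φ (r • x) = (Ideal.Quotient.mk (Ideal.span {T}) r) • Φ x) :
    finrank (R ⧸ Ideal.span {T}) (CharacterModule N') =
      finrank (R ⧸ Ideal.span {T}) (torsionBy R (CharacterModule N) T) := by
  have hΦ' : ∀ (r : R) (y : N'), Φ.symm ((Ideal.Quotient.mk (Ideal.span {T}) r) • y) = r • Φ.symm y :=
    fun r y => by apply Φ.injective; rw [hΦ, Φ.apply_symm_apply, Φ.apply_symm_apply]
  have hT : ∀ χ : CharacterModule N, (χ.comp Φ.symm.toAddMonoidHom : CharacterModule N') = 0 →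
      χ = 0 := fun χ h => by
    ext x
    have := DFunLike.congr_fun h (Φ x)
    change χ (Φ.symm (Φ x)) = 0 at this
    rw [Φ.symm_apply_apply] at this
    exact this
  let ψ : torsionBy R (CharacterModule N) T →ₗ[R ⧸ Ideal.span {T}] CharacterModule N' :=
    { toFun := fun χ => ((χ : CharacterModule N) : N →+ AddCircle (1 : ℚ)).comp Φ.symm.toAddMonoidHom
      map_add' := fun χ χ' => by ext y; rfl
      map_smul' := fun s χ => by
        obtain ⟨r, rfl⟩ := Ideal.Quotient.mk_surjective s
        ext y
        change ((r • (χ : CharacterModule N)) : CharacterModule N) (Φ.symm y) =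
          (χ : CharacterModule N) (Φ.symm ((Ideal.Quotient.mk (Ideal.span {T}) r) • y))
        rw [CharacterModule.smul_apply, hΦ'] }
  have hψ : Function.Bijective ψ := by
    constructor
    · rw [injective_iff_map_eq_zero]
      intro χ hχ
      exact Subtype.ext (hT _ hχ)
    · intro χ'
      let χ₀ : CharacterModule N := χ'.comp Φ.toAddMonoidHom
      have hmem : χ₀ ∈ torsionBy R (CharacterModule N) T := by
        rw [mem_torsionBy_iff]
        ext x
        change χ' (Φ (T • x)) = 0
        rw [hΦ, Ideal.Quotient.eq_zero_iff_mem.mpr (Ideal.mem_span_singleton_self T), zero_smul,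
          map_zero]
      refine ⟨⟨χ₀, hmem⟩, ?_⟩
      ext y
      change χ' (Φ (Φ.symm y)) = χ' y
      rw [Φ.apply_symm_apply]
  exact ((LinearEquiv.ofBijective ψ hψ).finrank_eq).symm

end Transport

/-! ## §2. Cotorsion submodules do not change coranks -/

section Cotorsion

variable {R : Type} [CommRing R] [TopologicalSpace R] [IsDomain R]
variable {Γ : Type} [Group Γ] [TopologicalSpace Γ] [IsTopologicalGroup Γ] [CompactSpace Γ]
variable {D : Type} [AddCommGroup D] [Module R D] [TopologicalSpace D] [DiscreteTopology D]
  [ContinuousSMul R D]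

omit [TopologicalSpace R] [TopologicalSpace D] [DiscreteTopology D] [ContinuousSMul R D] in
/-- If `u D ⊆ D'` with `u ≠ 0` then `rank_R D^∨ = rank_R D'^∨` (`(D/D')^∨` is killed by `u`).
[cite: Greenberg2006, §4 A (p. 368 L27–29: "`D/D_{Λ-div}` is `Λ`-cotorsion")] -/
theorem finrank_characterModule_eq_of_smul_mem (D' : Submodule R D) {u : R} (hu : u ≠ 0)
    (hquot : ∀ d : D, u • d ∈ D') [Module.Finite R (CharacterModule D)]
    [Module.Finite R (CharacterModule D')] :
    finrank R (CharacterModule D) = finrank R (CharacterModule D') := by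
  refine finrank_eq_of_exact_of_smul_eq_zero (CharacterModule.dual D'.mkQ)
    (CharacterModule.dual D'.subtype) (0 : CharacterModule D' →ₗ[R] PUnit.{1})
    (CharacterModule.exact_dual fun d => ?_) (fun χ => ?_) hu (fun χ => ?_) (fun _ => rfl)
  · rw [Submodule.mkQ_apply, Submodule.Quotient.mk_eq_zero]
    exact ⟨fun h => ⟨⟨d, h⟩, rfl⟩, by rintro ⟨y, rfl⟩; exact y.2⟩
  · simp only [LinearMap.zero_apply, true_iff]
    exact CharacterModule.dual_surjective_of_injective _ D'.injective_subtype χ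
  · ext q
    obtain ⟨d, rfl⟩ := Submodule.mkQ_surjective D' q
    rw [CharacterModule.smul_apply, Submodule.mkQ_apply, ← Submodule.Quotient.mk_smul,
      (Submodule.Quotient.mk_eq_zero D').mpr (hquot d), map_zero]
    rfl

/-- **Cotorsion submodules do not change the coranks of cohomology**: if `D' ≤ D` is `Γ`-stable
and `u D ⊆ D'` for some `u ≠ 0`, then `rank_R Hⁿ(Γ, D)^∨ = rank_R Hⁿ(Γ, D')^∨` for every `n` — the
long exact sequence of `0 → D' → D → D/D' → 0` has the terms `H^*(Γ, D/D')` killed by `u`.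
[cite: Greenberg2006, §4 A (p. 368 L25–29)] -/
theorem finrank_characterModule_H_eq_of_smul_mem (τ : ContinuousRep Γ R D) (D' : Submodule R D)
    (hD' : ∀ g, D' ≤ D'.comap (τ g)) {u : R} (hu : u ≠ 0) (hquot : ∀ d : D, u • d ∈ D') (n : ℕ)
    [Module.Finite R (CharacterModule (τ.H n))]
    [Module.Finite R (CharacterModule ((τ.subrepresentation D' hD').H n))] :
    finrank R (CharacterModule (τ.H n)) =
      finrank R (CharacterModule ((τ.subrepresentation D' hD').H n)) := by
  let σ := τ.subrepresentation D' hD'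
  let κ := τ.quotient D' hD'
  let j : σ.toTopRep ⟶ τ.toTopRep := TopRep.ofHom
    { toLinearMap := D'.subtype
      cont := continuous_subtype_val
      isIntertwining' := fun _ => rfl }
  let π : τ.toTopRep ⟶ κ.toTopRep := τ.mkQHom D' hD'
  have hSES : IsSES j π :=
    { comp_eq_zero := by
        ext w
        change Submodule.Quotient.mk (p := D') (w : D) = 0
        exact (Submodule.Quotient.mk_eq_zero D').2 w.2
      injective := Subtype.val_injective
      exact_mid := fun y hy => ⟨⟨y, (Submodule.Quotient.mk_eq_zero D').1 hy⟩, rfl⟩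
      surjective := Submodule.Quotient.mk_surjective D' }
  -- `u` kills `D/D'`, hence `H^m(Γ, D/D')` and its dual
  have hκ : ∀ q : D ⧸ D', u • q = 0 := fun q => by
    obtain ⟨d, rfl⟩ := Submodule.mkQ_surjective D' q
    rw [Submodule.mkQ_apply, ← Submodule.Quotient.mk_smul, (Submodule.Quotient.mk_eq_zero D').mpr (hquot d)]
  have hκH : ∀ (m : ℕ) (χ : CharacterModule (κ.H m)), u • χ = 0 := fun m χ => by
    ext c
    have h0 : u • c = 0 := κ.smul_continuousCohomology_eq_zero u hκ m c
    rw [CharacterModule.smul_apply, h0, map_zero]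
    rfl
  cases n with
  | zero =>
    obtain ⟨f₀, g₀, hf₀, hex⟩ := hSES.exists_exact_zero
    exact finrank_eq_of_exact_of_smul_eq_zero (CharacterModule.dual g₀) (CharacterModule.dual f₀)
      (0 : CharacterModule (σ.H 0) →ₗ[R] PUnit.{1}) (CharacterModule.exact_dual hex)
      (fun χ => by
        simp only [LinearMap.zero_apply, true_iff]
        exact CharacterModule.dual_surjective_of_injective _ hf₀ χ)
      hu (hκH 0) (fun _ => rfl)
  | succ n =>
    obtain ⟨gn, δ, f₁, g₁, h1, h2, h3⟩ := hSES.exists_exact n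
    exact finrank_eq_of_exact_of_smul_eq_zero (CharacterModule.dual g₁) (CharacterModule.dual f₁)
      (CharacterModule.dual δ) (CharacterModule.exact_dual h3) (CharacterModule.exact_dual h2)
      hu (hκH (n + 1)) (hκH n)

end Cotorsion

/-! ## §3. The alternating sum over `R'` for `A = D[T]` equals the alternating sum over `R` for `D` -/

section ModT

variable {R : Type} [CommRing R] [TopologicalSpace R] [IsNoetherianRing R] [IsDomain R]
variable {Γ : Type} [Group Γ] [TopologicalSpace Γ] [IsTopologicalGroup Γ] [CompactSpace Γ]
variable {M₁ : Type} [AddCommGroup M₁] [Module R M₁] [TopologicalSpace M₁] [DiscreteTopology M₁]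
  [ContinuousSMul R M₁]
variable {M₂ : Type} [AddCommGroup M₂] [Module R M₂] [TopologicalSpace M₂] [DiscreteTopology M₂]
  [ContinuousSMul R M₂]

/-- **Greenberg's reduction step for Euler characteristics, in ranks.**  Let `T ≠ 0` be a prime
element of the Noetherian domain `R` with `R' = R/(T)` a domain, and let
`0 → A →ι D →(T·) D → 0` be a short exact sequence of discrete `Γ`-modules over `R` (`D` is
`T`-divisible, `A = D[T]` is killed by `T`) with `H³(Γ, A) = 0` and all `Hⁱ(Γ, ·)^∨` finitely
generated.  Then
`Σ_{i=0}^{2} (−1)ⁱ rank_{R'} Hⁱ(Γ, A)^∨ = Σ_{i=0}^{2} (−1)ⁱ rank_R Hⁱ(Γ, D)^∨`,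
where `Hⁱ(Γ, A)^∨`, an `R`-module killed by `T`, is read as the `R'`-module `Hⁱ(Γ, A)^∨[T]`.
(Long exact sequence `Hⁱ⁻¹(D) →T Hⁱ⁻¹(D) → Hⁱ(A) → Hⁱ(D) →T Hⁱ(D)`, dualised, combined with
`rank_R X = rank_{R'} X/TX − rank_{R'} X[T]`.) [cite: Greenberg2006, §4 A (proof of Props. 4.1/4.2, p. 368 L34–52)] -/
theorem alternatingSum_finrank_torsionBy_characterModule_H_eq {T : R} (hT0 : T ≠ 0)
    (hT : (Ideal.span {T}).IsPrime) (σA : ContinuousRep Γ R M₁) (σ : ContinuousRep Γ R M₂)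
    {ι : σA.toTopRep ⟶ σ.toTopRep} {μ : σ.toTopRep ⟶ σ.toTopRep} (h : IsSES ι μ)
    (hμ : ∀ m : M₂, μ.hom m = T • m) (hA : ∀ a : M₁, T • a = 0) (h3 : Subsingleton (σA.H 3))
    (hfin : ∀ n, Module.Finite R (CharacterModule (σ.H n)))
    (hfinA : ∀ n, Module.Finite R (CharacterModule (σA.H n))) :
    (finrank (R ⧸ Ideal.span {T}) (torsionBy R (CharacterModule (σA.H 0)) T) : ℤ) -
        finrank (R ⧸ Ideal.span {T}) (torsionBy R (CharacterModule (σA.H 1)) T) +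
        finrank (R ⧸ Ideal.span {T}) (torsionBy R (CharacterModule (σA.H 2)) T) =
      (finrank R (CharacterModule (σ.H 0)) : ℤ) - finrank R (CharacterModule (σ.H 1)) +
        finrank R (CharacterModule (σ.H 2)) := by
  haveI : IsDomain (R ⧸ Ideal.span {T}) := (Ideal.Quotient.isDomain_iff_prime _).mpr hT
  haveI := hfin; haveI := hfinA
  -- `T` kills `Hⁿ(Γ, A)` and its dual
  have hZ : ∀ (n : ℕ) (z : CharacterModule (σA.H n)), T • z = 0 := fun n z => by
    ext c
    have h0 : T • c = 0 := σA.smul_continuousCohomology_eq_zero T hA n c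
    rw [CharacterModule.smul_apply, h0, map_zero]
    rfl
  -- degree 0: `(H⁰ A)^∨ ≅ X⁰/TX⁰`
  obtain ⟨ι₀, hι₀, e₀⟩ := h.exists_exact_smul_zero hμ
  have d0 := finrank_torsionBy_eq_of_surjective T (CharacterModule.dual ι₀) (hZ 0)
    (by simpa only [CharacterModule.dual_smul_id] using CharacterModule.exact_dual e₀)
    (CharacterModule.dual_surjective_of_injective _ hι₀)
  -- degrees 1, 2: `(Hⁿ⁺¹ A)^∨` is an extension of `Xⁿ[T]` by `Xⁿ⁺¹/TXⁿ⁺¹`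
  have dsucc : ∀ n : ℕ, finrank (R ⧸ Ideal.span {T}) (torsionBy R (CharacterModule (σA.H (n + 1))) T) =
      finrank (R ⧸ Ideal.span {T})
          (CharacterModule (σ.H (n + 1)) ⧸ (Ideal.span {T} • ⊤ : Submodule R (CharacterModule (σ.H (n + 1))))) +
        finrank (R ⧸ Ideal.span {T}) (torsionBy R (CharacterModule (σ.H n)) T) := fun n => by
    obtain ⟨δ, ι₁, e1, e2, e3⟩ := h.exists_exact_smul hμ n
    exact finrank_torsionBy_eq_add_of_exact T (CharacterModule.dual ι₁) (CharacterModule.dual δ)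
      (hZ (n + 1)) (by simpa only [CharacterModule.dual_smul_id] using CharacterModule.exact_dual e3)
      (CharacterModule.exact_dual e2)
      (by simpa only [CharacterModule.dual_smul_id] using CharacterModule.exact_dual e1)
  -- `X²[T] = 0` because `T·` is onto `H²(Γ, D)` (`H³(Γ, A) = 0`)
  have s2 : finrank (R ⧸ Ideal.span {T}) (torsionBy R (CharacterModule (σ.H 2)) T) = 0 := by
    obtain ⟨δ, ι₁, e1, -, -⟩ := h.exists_exact_smul hμ 2
    have hsurj : Function.Surjective (T • (LinearMap.id : σ.H 2 →ₗ[R] σ.H 2)) := fun c =>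
      (e1 c).mp (Subsingleton.elim _ _)
    have hinj := CharacterModule.dual_injective_of_surjective _ hsurj
    rw [CharacterModule.dual_smul_id] at hinj
    haveI : Subsingleton (torsionBy R (CharacterModule (σ.H 2)) T) := ⟨fun x y => Subtype.ext (hinj (by
      have hx := (mem_torsionBy_iff T (x : CharacterModule (σ.H 2))).mp x.2
      have hy := (mem_torsionBy_iff T (y : CharacterModule (σ.H 2))).mp y.2
      simp only [LinearMap.smul_apply, LinearMap.id_coe, id_eq, hx, hy]))⟩
    exact finrank_zero_of_subsingleton
  -- `rank_R Xⁿ = rank_{R'} Xⁿ/TXⁿ − rank_{R'} Xⁿ[T]`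
  have r := fun n => finrank_eq_finrank_quotient_sub_finrank_torsionBy hT0 hT (CharacterModule (σ.H n))
  have r0 := r 0; have r1 := r 1; have r2 := r 2
  have d1 := dsucc 0; have d2 := dsucc 1
  zify at d0 d1 d2 s2
  linarith

end ModT

/-! ## §4. The `R'`-ranks for `A` as an `R'`-representation -/

section QuotientRep

variable {R : Type} [CommRing R] [TopologicalSpace R] [IsTopologicalRing R] (T : R)
variable {Γ : Type} [Group Γ] [TopologicalSpace Γ] [IsTopologicalGroup Γ] [CompactSpace Γ]
variable {M : Type} [AddCommGroup M] [Module R M] [Module (R ⧸ Ideal.span {T}) M]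
  [IsScalarTower R (R ⧸ Ideal.span {T}) M] [TopologicalSpace M] [DiscreteTopology M]
  [ContinuousSMul R M] [ContinuousSMul (R ⧸ Ideal.span {T}) M]

omit [CompactSpace Γ] in
/-- **`rank_{R'} Hⁿ(Γ, A)_{R'}^∨ = rank_{R'} (Hⁿ(Γ, A)_R^∨[T])`**: for the `R'`-representation with
the same action as the `R`-representation `σA` on the `R'`-module `A`, the Pontryagin dual of its
cohomology (an `R'`-module) has the same `R'`-rank as the (automatically `T`-killed) dual of the
cohomology of `σA`. [cite: Greenberg2006, §4 A (proof of Props. 4.1/4.2, p. 368 L49–52)] -/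
theorem finrank_characterModule_H_quotientRing_eq (σA : ContinuousRep Γ R M)
    (τA : ContinuousRep Γ (R ⧸ Ideal.span {T}) M) (hστ : ∀ (g : Γ) (m : M), τA g m = σA g m)
    (n : ℕ) :
    finrank (R ⧸ Ideal.span {T}) (CharacterModule (τA.H n)) =
      finrank (R ⧸ Ideal.span {T}) (torsionBy R (CharacterModule (σA.H n)) T) := by
  have hσ : ∀ (g : Γ) (m : M), (ContinuousAddEquiv.refl M) (σA g m) =
      τA g ((ContinuousAddEquiv.refl M) m) := fun g m => (hστ g m).symm
  exact finrank_characterModule_eq_finrank_torsionBy_of_addEquiv T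
    (ContinuousRep.HAddEquivOfContinuousAddEquiv σA τA (ContinuousAddEquiv.refl M) hσ n)
    (fun r c => HAddEquivOfContinuousAddEquiv_smul (Ideal.span {T}) σA τA hσ n r c)

omit [TopologicalSpace R] [IsTopologicalRing R] [TopologicalSpace M] [DiscreteTopology M]
  [ContinuousSMul R M] [ContinuousSMul (R ⧸ Ideal.span {T}) M] in
/-- `rank_{R'} A_{R'}^∨ = rank_{R'} (A_R^∨[T])` for an `R'`-module `A` (with its compatible `R`-structure).
[cite: Greenberg2006, §4 A (proof of Props. 4.1/4.2, p. 368 L49–52)] -/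
theorem finrank_characterModule_quotientRing_eq :
    finrank (R ⧸ Ideal.span {T}) (CharacterModule M) =
      finrank (R ⧸ Ideal.span {T}) (torsionBy R (CharacterModule M) T) :=
  finrank_characterModule_eq_finrank_torsionBy_of_addEquiv T (AddEquiv.refl M) fun r x => by
    change r • x = (Ideal.Quotient.mk (Ideal.span {T}) r) • x
    rw [← Ideal.Quotient.algebraMap_eq, IsScalarTower.algebraMap_smul]

end QuotientRep

end Literature.NumberTheory.GaloisRepresentations

end
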